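import Summits.CriticalPhenomena.PercolationContinuityZ3.Theorems.Transplant.FKConnectivityAllQApexTriangle
import HarnessLib

/-!
# Connectivity correlation inequalities for `φ_{w,q}`, every `q > 0` — file 9h: apex elimination, CLOSED FORMS ON THE DIAMOND
# (`S_w(x ↔ y)` and `Z_w` for two apices `x, y` over the same base pair `(z,t)`)

Support file (`--supports stmt-CriticalPhenomena-4575`), FK sub-lane `prim-bschramm-fk-1` (gen 5) of the post-continuity
programme; builds on p205010 (kernel theorem, internal audit signed; external expert review pending).  No definitions, no named
facts, no sorries; standard axioms.

THE `K₄` COMPUTATION (files `…ApexTriangle`, `…ApexDiamond`, `…DiamondCertificates`, `…K4`).  Wagner (Ann. Comb. 2008, Ex. 5.1)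
reports an unpublished computation of A. Sokal (2005) that the Potts model of `K₄` is Rayleigh for all `0 < q ≤ 1`, i.e. `φ_{w,q}` on
`K₄` is edge-negatively associated for every weight vector.  We certify it in the kernel: by fk-2's master identity, negative
association of the pair `xy` with `f` on `K₄` is EC⁺ for `x ↔ y` in the diamond `K₄ − xy` (tips `x, y`, base pair `zt`), in which
`y` is an apex over `(z,t)` and `x` a second apex over `(z,t)`; two rounds of the apex identities express `S_w(x ↔ y)` and `Z_w` as
explicit polynomials in the five parameters, `r = q⁻¹` and the two base masses `A = S°°(z ↔ t)`, `B = S°°(z ↮ t)`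
(`dia_closed_forms`); the three EC⁺ comparisons (`f` = side pair `zx`, tip pair `zy`, base pair `zt`; the other two by the
`z ↔ t` symmetry) are then polynomial inequalities, each closed by an explicit nonnegativity certificate in Bernstein form
(products of `w_e`, `1 − w_e`, `r − 1`, `A`, `B` with positive coefficients, plus one square for the base pair) found by computer
algebra and checked by `ring`.

THIS FILE: `dia_mass_univ`, `dia_mass_xy` (one round of apex identities at `x`), and **`dia_closed_forms`**: `S_w(x ↔ y)` and `Z_w`
as explicit polynomials in `w_a, w_b, w_c, w_d` (`a = zx`, `b = xt`, `c = zy`, `d = yt`), `r = q⁻¹` and the base masses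
`A = S_{w°°}(K)`, `B = S_{w°°}(Kᶜ)` (`w°° = w[a,b,c,d ↦ 0]`, `K = {z ↔ t avoiding c, d}`).  Valid on any finite vertex type as soon
as every live pair at `x` and every live pair at `y` contains `z` or `t` (other vertices and pairs are arbitrary).
[cite: Grimmett2006, Thm. (3.1)(a) (p. 37); §1.4 eq. (1.20) (p. 15)] [cite: Wagner2006, Ex. 5.1]
-/

noncomputable section

namespace Summit.CriticalPhenomena.PercolationContinuityZ3.Theorems

namespace FK

open MeasureTheory Set Literature.Probability.LatticeModels Literature.Probability.Percolation
open Literature.Probability.Percolation.DecisionTree (ind ind_of_mem ind_of_not_mem ind_nonneg)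
open Literature.Probability.Percolation.TwoAvoidanceSets (ind_mul_ind)
open scoped Classical symmDiff

variable {V : Type*} [Fintype V]

/-! ### Closed forms on the diamond (apex `x` over `(z,t)` on top of an apex `y` over `(z,t)`): `S_w(x ↔ y)` and `Z_w` -/

omit [Fintype V] in
/-- Events of the form `{ω | ω ∖ {a,b} ∈ E}` are insensitive to the apex pairs `a, b`. [folklore] -/
theorem diffApex_insens (u v x : V) (E : Set (BondConfig V)) {e : Sym2 V} (he : e = s(u, x) ∨ e = s(x, v)) (ω : BondConfig V) :
    ω ∆ {e} ∈ {ω : BondConfig V | ω \ {s(u, x), s(x, v)} ∈ E} ↔ ω ∈ {ω : BondConfig V | ω \ {s(u, x), s(x, v)} ∈ E} := by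
  simp only [Set.mem_setOf_eq]
  rw [symmDiff_apex_diff ω u v x he]

omit [Fintype V] in
/-- `{t ↔ y} ∩ {z ↔ t} = {z ↔ y} ∩ {z ↔ t}` (both say that `y, z, t` lie in one cluster). [folklore] -/
theorem openConn_ty_inter_zt (z t y : V) :
    (openConn t y : Set (BondConfig V)) ∩ (openConn z t : Set (BondConfig V)) = (openConn z y : Set (BondConfig V)) ∩ openConn z t := by
  ext ω
  simp only [Set.mem_inter_iff, mem_openConn_iff']
  constructor
  · rintro ⟨h1, h2⟩; exact ⟨h2.trans h1, h2⟩
  · rintro ⟨h1, h2⟩; exact ⟨h2.symm.trans h1, h2⟩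

omit [Fintype V] in
/-- `{z ↔ y} ∩ {t ↔ y} = {z ↔ y} ∩ {z ↔ t}`. [folklore] -/
theorem openConn_zy_inter_ty (z t y : V) :
    (openConn z y : Set (BondConfig V)) ∩ (openConn t y : Set (BondConfig V)) = (openConn z y : Set (BondConfig V)) ∩ openConn z t := by
  ext ω
  simp only [Set.mem_inter_iff, mem_openConn_iff']
  constructor
  · rintro ⟨h1, h2⟩; exact ⟨h1, h1.trans h2.symm⟩
  · rintro ⟨h1, h2⟩; exact ⟨h1, h2.symm.trans h1⟩

/-- **Diamond level, `Ω`**: with `x` an apex over `(z,t)` (`a = zx`, `b = xt`), `Z_w = ((1−w_a)+w_a q⁻¹)((1−w_b)+w_b q⁻¹)·Z_{w¹} −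
w_a w_b q⁻¹(q⁻¹−1)·S_{w¹}(z ↔ t)`, `w¹ = w[a↦0][b↦0]`. [cite: Grimmett2006, Thm. (3.1)(a) (p. 37); §1.4 eq. (1.20) (p. 15)] -/
theorem dia_mass_univ (w : Sym2 V → unitInterval) {q : ℝ} (hq : q ≠ 0) {z t x : V} (hxz : x ≠ z) (hxt : x ≠ t) (hzt : z ≠ t)
    (hw : ∀ e : Sym2 V, x ∈ e → ((w e : unitInterval) : ℝ) ≠ 0 → z ∈ e ∨ t ∈ e) :
    rcPartitionFunctionW w q ∅ =
      ((1 - ((w s(z, x) : unitInterval) : ℝ)) + ((w s(z, x) : unitInterval) : ℝ) * q⁻¹) *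
          ((1 - ((w s(x, t) : unitInterval) : ℝ)) + ((w s(x, t) : unitInterval) : ℝ) * q⁻¹) *
          rcPartitionFunctionW (Function.update (Function.update w s(z, x) 0) s(x, t) 0) q ∅ -
        ((w s(z, x) : unitInterval) : ℝ) * ((w s(x, t) : unitInterval) : ℝ) * q⁻¹ * (q⁻¹ - 1) *
          ∑ ω : BondConfig V, rcWeightW (Function.update (Function.update w s(z, x) 0) s(x, t) 0) q ∅ ω *
            ind (openConn z t : Set (BondConfig V)) ω := by
  have hab := apex_pairs_ne hxz hzt
  have hU : ∀ g : Sym2 V, ∀ ω : BondConfig V, ω ∆ {g} ∈ (Set.univ : Set (BondConfig V)) ↔ ω ∈ (Set.univ : Set (BondConfig V)) :=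
    fun g ω => by simp
  have h := apex_mass w hq hxz hxt hzt hw Set.univ (hU _) (hU _)
  rw [sum_rcWeightW_ind_univ, sum_rcWeightW_ind_univ, Set.univ_inter] at h
  have hw1 := apex_hyp_update (apex_hyp_update hw s(z, x) (fun _ => Or.inl (Sym2.mem_mk_left z x)) 0) s(x, t)
    (fun _ => Or.inr (Sym2.mem_mk_right x t)) 0
  have ha0 : ((Function.update (Function.update w s(z, x) 0) s(x, t) 0 s(z, x) : unitInterval) : ℝ) = 0 := by
    rw [Function.update_of_ne hab]; simp
  have hb0 : ((Function.update (Function.update w s(z, x) 0) s(x, t) 0 s(x, t) : unitInterval) : ℝ) = 0 := by simp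
  have hK : ∑ ω : BondConfig V, rcWeightW (Function.update (Function.update w s(z, x) 0) s(x, t) 0) q ∅ ω *
      ind {ω : BondConfig V | ω \ {s(z, x), s(x, t)} ∈ (openConn z t : Set (BondConfig V))} ω =
      ∑ ω : BondConfig V, rcWeightW (Function.update (Function.update w s(z, x) 0) s(x, t) 0) q ∅ ω *
        ind (openConn z t : Set (BondConfig V)) ω := by
    refine sum_rcWeightW_ind_congr_ae _ q fun ω hω => ?_
    rw [Set.mem_setOf_eq, diff_apex_eq_self_ae _ q ha0 hb0 hω]
  rw [h, hK]

/-- **Diamond level, `x ↔ y`**: with `x` an apex over `(z,t)` (`a = zx`, `b = xt`), `y ∉ {x,z,t}`, and `w¹ = w[a↦0][b↦0]`: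
`S_w(x ↔ y) = w_a(q⁻¹P_b S¹(z↔y) − (q⁻¹−1)w_b q⁻¹ S¹(z↔y, z↔t)) + w_b(q⁻¹P_a S¹(t↔y) − (q⁻¹−1)w_a q⁻¹ S¹(z↔y, z↔t)) − w_a w_b q⁻¹ S¹(z↔y, z↔t)`.
[cite: Grimmett2006, Thm. (3.1)(a) (p. 37); §1.4 eq. (1.20) (p. 15)] -/
theorem dia_mass_xy (w : Sym2 V → unitInterval) {q : ℝ} (hq : q ≠ 0) {z t x y : V} (hxz : x ≠ z) (hxt : x ≠ t) (hxy : x ≠ y)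
    (hzt : z ≠ t) (hw : ∀ e : Sym2 V, x ∈ e → ((w e : unitInterval) : ℝ) ≠ 0 → z ∈ e ∨ t ∈ e) :
    ∑ ω : BondConfig V, rcWeightW w q ∅ ω * ind (openConn x y : Set (BondConfig V)) ω =
      ((w s(z, x) : unitInterval) : ℝ) *
          (q⁻¹ * ((1 - ((w s(x, t) : unitInterval) : ℝ)) + ((w s(x, t) : unitInterval) : ℝ) * q⁻¹) *
              ∑ ω : BondConfig V, rcWeightW (Function.update (Function.update w s(z, x) 0) s(x, t) 0) q ∅ ω *
                ind (openConn z y : Set (BondConfig V)) ω -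
            (q⁻¹ - 1) * ((w s(x, t) : unitInterval) : ℝ) * q⁻¹ *
              ∑ ω : BondConfig V, rcWeightW (Function.update (Function.update w s(z, x) 0) s(x, t) 0) q ∅ ω *
                ind ((openConn z y : Set (BondConfig V)) ∩ openConn z t) ω) +
        ((w s(x, t) : unitInterval) : ℝ) *
          (q⁻¹ * ((1 - ((w s(z, x) : unitInterval) : ℝ)) + ((w s(z, x) : unitInterval) : ℝ) * q⁻¹) *
              ∑ ω : BondConfig V, rcWeightW (Function.update (Function.update w s(z, x) 0) s(x, t) 0) q ∅ ω *
                ind (openConn t y : Set (BondConfig V)) ω -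
            (q⁻¹ - 1) * ((w s(z, x) : unitInterval) : ℝ) * q⁻¹ *
              ∑ ω : BondConfig V, rcWeightW (Function.update (Function.update w s(z, x) 0) s(x, t) 0) q ∅ ω *
                ind ((openConn z y : Set (BondConfig V)) ∩ openConn z t) ω) -
        ((w s(z, x) : unitInterval) : ℝ) * ((w s(x, t) : unitInterval) : ℝ) * q⁻¹ *
          ∑ ω : BondConfig V, rcWeightW (Function.update (Function.update w s(z, x) 0) s(x, t) 0) q ∅ ω *
            ind ((openConn z y : Set (BondConfig V)) ∩ openConn z t) ω := by
  have hab := apex_pairs_ne hxz hzt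
  set Fz : Set (BondConfig V) := {ω : BondConfig V | ω \ {s(z, x), s(x, t)} ∈ (openConn z y : Set (BondConfig V))} with hFz
  set Ft : Set (BondConfig V) := {ω : BondConfig V | ω \ {s(z, x), s(x, t)} ∈ (openConn t y : Set (BondConfig V))} with hFt
  set Kx : Set (BondConfig V) := {ω : BondConfig V | ω \ {s(z, x), s(x, t)} ∈ (openConn z t : Set (BondConfig V))} with hKx
  rw [apex_mass_openConn w q hxz hxt hxy hw]
  -- term 1
  have t1 := apex_mass_a_inter w hq hxz hxt hzt hw Fz (diffApex_insens z t x _ (Or.inl rfl)) (diffApex_insens z t x _ (Or.inr rfl))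
  -- term 2 (mirror `z ↔ t`)
  have hw' := apex_hyp_swap hw
  have hFt' : Ft = {ω : BondConfig V | ω \ {s(t, x), s(x, z)} ∈ (openConn t y : Set (BondConfig V))} := by
    ext ω; simp only [hFt, Set.mem_setOf_eq]
    rw [Sym2.eq_swap (a := t) (b := x), Sym2.eq_swap (a := x) (b := z), Set.pair_comm]
  have t2 := apex_mass_a_inter w hq hxt hxz hzt.symm hw' {ω : BondConfig V | ω \ {s(t, x), s(x, z)} ∈ (openConn t y : Set (BondConfig V))}
    (diffApex_insens t z x _ (Or.inl rfl)) (diffApex_insens t z x _ (Or.inr rfl))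
  rw [← hFt', apexAvoid_swap z t x, apexDead_swap w hxz hzt, Sym2.eq_swap (a := t) (b := x), Sym2.eq_swap (a := x) (b := z)] at t2
  -- term 3
  have t3 := apex_mass_ab_inter w hq hxz hxt hzt hw (Fz ∩ Ft)
    (inter_insens (diffApex_insens z t x _ (Or.inl rfl)) (diffApex_insens z t x _ (Or.inl rfl)))
    (inter_insens (diffApex_insens z t x _ (Or.inr rfl)) (diffApex_insens z t x _ (Or.inr rfl)))
  rw [t1, t2, t3]
  -- a.s. conversions in the apex-deleted state
  have hw1 := apex_hyp_update (apex_hyp_update hw s(z, x) (fun _ => Or.inl (Sym2.mem_mk_left z x)) 0) s(x, t)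
    (fun _ => Or.inr (Sym2.mem_mk_right x t)) 0
  have ha0 : ((Function.update (Function.update w s(z, x) 0) s(x, t) 0 s(z, x) : unitInterval) : ℝ) = 0 := by
    rw [Function.update_of_ne hab]; simp
  have hb0 : ((Function.update (Function.update w s(z, x) 0) s(x, t) 0 s(x, t) : unitInterval) : ℝ) = 0 := by simp
  have c1 : ∑ ω : BondConfig V, rcWeightW (Function.update (Function.update w s(z, x) 0) s(x, t) 0) q ∅ ω * ind Fz ω =
      ∑ ω : BondConfig V, rcWeightW (Function.update (Function.update w s(z, x) 0) s(x, t) 0) q ∅ ω *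
        ind (openConn z y : Set (BondConfig V)) ω := by
    refine sum_rcWeightW_ind_congr_ae _ q fun ω hω => ?_
    rw [hFz, Set.mem_setOf_eq, diff_apex_eq_self_ae _ q ha0 hb0 hω]
  have c2 : ∑ ω : BondConfig V, rcWeightW (Function.update (Function.update w s(z, x) 0) s(x, t) 0) q ∅ ω * ind (Fz ∩ Kx) ω =
      ∑ ω : BondConfig V, rcWeightW (Function.update (Function.update w s(z, x) 0) s(x, t) 0) q ∅ ω *
        ind ((openConn z y : Set (BondConfig V)) ∩ openConn z t) ω := by
    refine sum_rcWeightW_ind_congr_ae _ q fun ω hω => ?_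
    rw [hFz, hKx, Set.mem_inter_iff, Set.mem_setOf_eq, Set.mem_setOf_eq, diff_apex_eq_self_ae _ q ha0 hb0 hω, Set.mem_inter_iff]
  have c3 : ∑ ω : BondConfig V, rcWeightW (Function.update (Function.update w s(z, x) 0) s(x, t) 0) q ∅ ω * ind Ft ω =
      ∑ ω : BondConfig V, rcWeightW (Function.update (Function.update w s(z, x) 0) s(x, t) 0) q ∅ ω *
        ind (openConn t y : Set (BondConfig V)) ω := by
    refine sum_rcWeightW_ind_congr_ae _ q fun ω hω => ?_
    rw [hFt, Set.mem_setOf_eq, diff_apex_eq_self_ae _ q ha0 hb0 hω]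
  have c4 : ∑ ω : BondConfig V, rcWeightW (Function.update (Function.update w s(z, x) 0) s(x, t) 0) q ∅ ω * ind (Ft ∩ Kx) ω =
      ∑ ω : BondConfig V, rcWeightW (Function.update (Function.update w s(z, x) 0) s(x, t) 0) q ∅ ω *
        ind ((openConn z y : Set (BondConfig V)) ∩ openConn z t) ω := by
    rw [← openConn_ty_inter_zt]
    refine sum_rcWeightW_ind_congr_ae _ q fun ω hω => ?_
    rw [hFt, hKx, Set.mem_inter_iff, Set.mem_setOf_eq, Set.mem_setOf_eq, diff_apex_eq_self_ae _ q ha0 hb0 hω, Set.mem_inter_iff]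
  have c5 : ∑ ω : BondConfig V, rcWeightW (Function.update (Function.update w s(z, x) 0) s(x, t) 0) q ∅ ω * ind (Fz ∩ Ft) ω =
      ∑ ω : BondConfig V, rcWeightW (Function.update (Function.update w s(z, x) 0) s(x, t) 0) q ∅ ω *
        ind ((openConn z y : Set (BondConfig V)) ∩ openConn z t) ω := by
    rw [← openConn_zy_inter_ty]
    refine sum_rcWeightW_ind_congr_ae _ q fun ω hω => ?_
    rw [hFz, hFt, Set.mem_inter_iff, Set.mem_setOf_eq, Set.mem_setOf_eq, diff_apex_eq_self_ae _ q ha0 hb0 hω, Set.mem_inter_iff]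
  have c6 : ∑ ω : BondConfig V, rcWeightW (Function.update (Function.update w s(z, x) 0) s(x, t) 0) q ∅ ω * ind (Fz ∩ Ft ∩ Kxᶜ) ω = 0 := by
    refine sum_rcWeightW_ind_eq_zero_ae _ q fun ω hω hmem => ?_
    rw [hFz, hFt, hKx, Set.mem_inter_iff, Set.mem_inter_iff, Set.mem_compl_iff, Set.mem_setOf_eq, Set.mem_setOf_eq,
      Set.mem_setOf_eq, diff_apex_eq_self_ae _ q ha0 hb0 hω, mem_openConn_iff', mem_openConn_iff', mem_openConn_iff'] at hmem
    exact hmem.2 (hmem.1.1.trans hmem.1.2.symm)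
  rw [c1, c2, c3, c4, c5, c6]
  ring


/-! ### The diamond: closed forms for `S_w(x ↔ y)` and `Z_w` in terms of the base masses `A = S°°(K)`, `B = S°°(Kᶜ)` -/

/-- **Diamond closed forms.**  Let `x` and `y` be two apices over the same base pair `(z,t)` (every live pair at `x`, resp. `y`,
contains `z` or `t`), `a = zx`, `b = xt`, `c = zy`, `d = yt`, `r = q⁻¹`, `w°° = w[a↦0][b↦0][c↦0][d↦0]`, `K = {z ↔ t avoiding c, d}`,
`A = S_{w°°}(K)`, `B = S_{w°°}(Kᶜ)`.  Then `S_w(x ↔ y)` and `Z_w` are the explicit polynomials below in `w_a, w_b, w_c, w_d, r, A, B`.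
[cite: Grimmett2006, Thm. (3.1)(a) (p. 37); §1.4 eq. (1.20) (p. 15)] -/
theorem dia_closed_forms (w : Sym2 V → unitInterval) {q : ℝ} (hq : q ≠ 0) {z t x y : V} (hxz : x ≠ z) (hxt : x ≠ t) (hxy : x ≠ y)
    (hyz : y ≠ z) (hyt : y ≠ t) (hzt : z ≠ t)
    (hwx : ∀ e : Sym2 V, x ∈ e → ((w e : unitInterval) : ℝ) ≠ 0 → z ∈ e ∨ t ∈ e)
    (hwy : ∀ e : Sym2 V, y ∈ e → ((w e : unitInterval) : ℝ) ≠ 0 → z ∈ e ∨ t ∈ e) :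
    let wa : ℝ := ((w s(z, x) : unitInterval) : ℝ)
    let wb : ℝ := ((w s(x, t) : unitInterval) : ℝ)
    let wc : ℝ := ((w s(z, y) : unitInterval) : ℝ)
    let wd : ℝ := ((w s(y, t) : unitInterval) : ℝ)
    let r : ℝ := q⁻¹
    let w00 := Function.update (Function.update (Function.update (Function.update w s(z, x) 0) s(x, t) 0) s(z, y) 0) s(y, t) 0
    let A : ℝ := ∑ ω : BondConfig V, rcWeightW w00 q ∅ ω *
      ind {ω : BondConfig V | ω \ {s(z, y), s(y, t)} ∈ (openConn z t : Set (BondConfig V))} ω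
    let B : ℝ := ∑ ω : BondConfig V, rcWeightW w00 q ∅ ω *
      ind {ω : BondConfig V | ω \ {s(z, y), s(y, t)} ∈ (openConn z t : Set (BondConfig V))}ᶜ ω
    let Mzy : ℝ := wc * (r * ((1 - wd) + wd * r) * (A + B) - (r - 1) * wd * r * A) + (wd * r - wc * wd * r) * A
    let Mty : ℝ := wd * (r * ((1 - wc) + wc * r) * (A + B) - (r - 1) * wc * r * A) + (wc * r - wd * wc * r) * A
    let M1 : ℝ := Mzy - wc * (1 - wd) * r * B
    let Z1 : ℝ := ((1 - wc) + wc * r) * ((1 - wd) + wd * r) * (A + B) - wc * wd * r * (r - 1) * A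
    let KZ : ℝ := ((1 - wc) * (1 - wd) + (wc + wd - wc * wd) * r) * A + wc * wd * (r * r) * B
    (∑ ω : BondConfig V, rcWeightW w q ∅ ω * ind (openConn x y : Set (BondConfig V)) ω =
        wa * (r * ((1 - wb) + wb * r) * Mzy - (r - 1) * wb * r * M1) + wb * (r * ((1 - wa) + wa * r) * Mty - (r - 1) * wa * r * M1) -
          wa * wb * r * M1) ∧
      rcPartitionFunctionW w q ∅ = ((1 - wa) + wa * r) * ((1 - wb) + wb * r) * Z1 - wa * wb * r * (r - 1) * KZ := by
  intro wa wb wc wd r w00 A B Mzy Mty M1 Z1 KZ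
  have hab := apex_pairs_ne hxz hzt
  have hcd := apex_pairs_ne hyz hzt
  -- the level-1 vector and its apex hypothesis at `y`
  set w1 := Function.update (Function.update w s(z, x) 0) s(x, t) 0 with hw1def
  have hya : y ∉ s(z, x) := by rw [Sym2.mem_iff]; rintro (h | h); exacts [hyz h, hxy h.symm]
  have hyb : y ∉ s(x, t) := by rw [Sym2.mem_iff]; rintro (h | h); exacts [hxy h.symm, hyt h]
  have hwy1 : ∀ e : Sym2 V, y ∈ e → ((w1 e : unitInterval) : ℝ) ≠ 0 → z ∈ e ∨ t ∈ e :=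
    apex_hyp_update (apex_hyp_update hwy s(z, x) (fun h => absurd h hya) 0) s(x, t) (fun h => absurd h hyb) 0
  have hca : s(z, y) ≠ s(z, x) := fun h => hya (h ▸ Sym2.mem_mk_right z y)
  have hcb : s(z, y) ≠ s(x, t) := fun h => hyb (h ▸ Sym2.mem_mk_right z y)
  have hda : s(y, t) ≠ s(z, x) := fun h => hya (h ▸ Sym2.mem_mk_left y t)
  have hdb : s(y, t) ≠ s(x, t) := fun h => hyb (h ▸ Sym2.mem_mk_left y t)
  have hc1 : ((w1 s(z, y) : unitInterval) : ℝ) = wc := by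
    rw [hw1def, Function.update_of_ne hcb, Function.update_of_ne hca]
  have hd1 : ((w1 s(y, t) : unitInterval) : ℝ) = wd := by
    rw [hw1def, Function.update_of_ne hdb, Function.update_of_ne hda]
  -- triangle-level closed forms for `w1`
  have ezy := tri_mass_zy w1 hq hyz hyt hzt hwy1
  have ety := tri_mass_zy w1 hq hyt hyz hzt.symm (apex_hyp_swap hwy1)
  rw [apexDead_swap w1 hyz hzt, apexAvoid_swap z t y, Sym2.eq_swap (a := t) (b := y), Sym2.eq_swap (a := y) (b := z)] at ety
  have ezt := tri_mass_zt w1 hq hyz hyt hzt hwy1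
  have eZ := tri_mass_univ w1 hq hyz hyt hzt hwy1
  have eno := tri_mass_zy_not_zt w1 hq hyz hyt hzt hwy1
  have eall := sum_rcWeightW_ind_inter_compl w1 q (openConn z y : Set (BondConfig V)) (openConn z t : Set (BondConfig V))
  rw [hc1, hd1] at ezy ety ezt eZ eno
  -- diamond level
  have dxy := dia_mass_xy w hq hxz hxt hxy hzt hwx
  have dZ := dia_mass_univ w hq hxz hxt hzt hwx
  rw [← hw1def] at dxy dZ
  -- `S_{w1}(zy ∩ zt)` via the complement split
  have eall' : ∑ ω : BondConfig V, rcWeightW w1 q ∅ ω * ind ((openConn z y : Set (BondConfig V)) ∩ openConn z t) ω = Mzy - wc * (1 - wd) * r * B := by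
    have : ∑ ω : BondConfig V, rcWeightW w1 q ∅ ω * ind ((openConn z y : Set (BondConfig V)) ∩ openConn z t) ω =
        ∑ ω : BondConfig V, rcWeightW w1 q ∅ ω * ind (openConn z y : Set (BondConfig V)) ω -
          ∑ ω : BondConfig V, rcWeightW w1 q ∅ ω * ind ((openConn z y : Set (BondConfig V)) ∩ (openConn z t : Set (BondConfig V))ᶜ) ω := by
      linarith [eall]
    rw [this, ezy, eno]
  constructor
  · rw [dxy, ezy, ety, eall']
  · rw [dZ, eZ, ezt]


end FK

end Summit.CriticalPhenomena.PercolationContinuityZ3.Theorems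

end
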